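import Mathlib.Topology.Algebra.RestrictedProduct.TopologicalSpace
import Mathlib.Topology.Bases
import Mathlib.Topology.Maps.OpenQuotient
import HarnessLib

/-!
# Restricted products: the box basis and open maps `∏' φ_i`

Topic `Topology`; namespace `Literature.Topology.RestrictedProduct`. THEOREMS ONLY (no definition, no instance).

For Mathlib's restricted product `Πʳ i, [G i, C i]` (filter `cofinite`) along OPEN subsets `C i`:

* `isOpen_box`, **`isTopologicalBasis_boxes`** — the sets `{x | (∀ i ∈ T, x_i ∈ W_i) ∧ ∀ i ∉ T, x_i ∈ C_i}`
  (`T` finite, `W_i ⊆ G_i` open) form a basis of the topology (the inductive-limit topology of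
  `RestrictedProduct.topologicalSpace_eq_iSup` seen through the open embeddings of the principal stages,
  `RestrictedProduct.isOpenEmbedding_inclusion_principal`);
* `image_map_box`, **`isOpenMap_map`** — for factor maps `φ_i : G_i → H_i` that are OPEN and satisfy
  `φ_i(C_i) = D_i`, the product map `RestrictedProduct.map φ : Πʳ [G_i, C_i] → Πʳ [H_i, D_i]` is open (images of
  boxes are boxes); `map_surjective`, `continuous_map`, `isOpenQuotientMap_map`.

The case in view: `φ_i = (G_i → G_i ⧸ H_i)` the quotient maps by closed subgroups and `D_i = φ_i(K_i)` — the adelic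
quotient `G(𝔸) ⧸ H(𝔸)` as the restricted product of the local quotients (Borel–Jacquet (1979) §4.1; the carrier of
factorizable ORBITAL integrals). Written for the cell `pub/hodgecm-mathlib`, ENGINE T1 (plan O13c, file Q1a).

## References

* A. Borel, H. Jacquet, *Automorphic forms and automorphic representations*, PSPM 33.1 (1979), §4.1 [BorelJacquet1979].
* N. Bourbaki, *General Topology*, Ch. I §4 (final topologies) — the inductive-limit description [folklore].
-/

set_option autoImplicit false

open Set Filter Topology TopologicalSpace Function
open scoped RestrictedProduct

namespace Literature.Topology.RestrictedProduct

universe u v w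

variable {ι : Type u} {G : ι → Type v} [∀ i, TopologicalSpace (G i)] {C : ∀ i, Set (G i)}

/-- **Boxes are open**: for `C_i` open, a finite `T` and opens `W_i` (`i ∈ T`), the box
`{x | (∀ i ∈ T, x_i ∈ W_i) ∧ ∀ i ∉ T, x_i ∈ C_i}` is open in `Πʳ i, [G i, C i]`. [cite: BorelJacquet1979, §4.1] -/
theorem isOpen_box (hC : ∀ i, IsOpen (C i)) (T : Finset ι) (W : ∀ i, Set (G i)) (hW : ∀ i ∈ T, IsOpen (W i)) :
    IsOpen {x : Πʳ i, [G i, C i] | (∀ i ∈ T, x i ∈ W i) ∧ ∀ i ∉ T, x i ∈ C i} := by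
  have h1 : IsOpen {x : Πʳ i, [G i, C i] | ∀ i ∈ T, x i ∈ W i} := by
    have : {x : Πʳ i, [G i, C i] | ∀ i ∈ T, x i ∈ W i} =
        ⋂ i ∈ T, (fun x : Πʳ i, [G i, C i] => x i) ⁻¹' W i := by
      ext x
      simp only [mem_setOf_eq, mem_iInter, mem_preimage]
    rw [this]
    exact isOpen_biInter_finset fun i hi => (hW i hi).preimage (RestrictedProduct.continuous_eval i)
  exact h1.and (RestrictedProduct.isOpen_forall_imp_mem hC)

/-- **The box basis of a restricted product** along open subsets: the boxes
`{x | (∀ i ∈ T, x_i ∈ W_i) ∧ ∀ i ∉ T, x_i ∈ C_i}`, `T` finite, `W_i` open, form a basis of the topology of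
`Πʳ i, [G i, C i]`. [cite: BorelJacquet1979, §4.1] -/
theorem isTopologicalBasis_boxes (hC : ∀ i, IsOpen (C i)) :
    IsTopologicalBasis {U : Set (Πʳ i, [G i, C i]) | ∃ (T : Finset ι) (W : ∀ i, Set (G i)),
      (∀ i ∈ T, IsOpen (W i)) ∧ U = {x | (∀ i ∈ T, x i ∈ W i) ∧ ∀ i ∉ T, x i ∈ C i}} := by
  classical
  refine isTopologicalBasis_of_isOpen_of_nhds ?_ ?_
  · rintro U ⟨T, W, hW, rfl⟩
    exact isOpen_box hC T W hW
  · intro x U hxU hU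
    -- the finite exceptional set of `x`
    have hfin : Set.Finite {i | ¬ x i ∈ C i} := by
      have hx : ∀ᶠ i in cofinite, x i ∈ C i := x.2
      rwa [eventually_cofinite] at hx
    set T : Finset ι := hfin.toFinset with hT
    have hxT : ∀ i, i ∉ T → x i ∈ C i := fun i hi => by
      by_contra h
      exact hi (hfin.mem_toFinset.2 h)
    -- `x` comes from the principal stage `S = Tᶜ`
    have hS : (cofinite : Filter ι) ≤ 𝓟 ((↑T : Set ι)ᶜ) :=
      le_principal_iff.2 T.finite_toSet.compl_mem_cofinite
    obtain ⟨x₀, hx₀⟩ : x ∈ range (RestrictedProduct.inclusion G C hS) := by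
      rw [RestrictedProduct.range_inclusion]
      exact eventually_principal.2 fun i hi => hxT i hi
    have hxi : ∀ i, x i = x₀ i := fun i => by rw [← hx₀]; rfl
    have hU₀ : IsOpen (RestrictedProduct.inclusion G C hS ⁻¹' U) :=
      hU.preimage (RestrictedProduct.continuous_inclusion hS)
    -- the principal stage carries the subspace topology of `Π i, G i`
    obtain ⟨V, hV, hVU⟩ :=
      (RestrictedProduct.isEmbedding_coe_of_principal (R := G) (A := C) (S := ((↑T : Set ι)ᶜ))).isInducing.isOpen_iff.1
        hU₀
    have hx₀V : (x₀ : Π i, G i) ∈ V := by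
      have : x₀ ∈ ((↑) : (Πʳ i, [G i, C i]_[𝓟 ((↑T : Set ι)ᶜ)]) → Π i, G i) ⁻¹' V := by
        rw [hVU, mem_preimage, hx₀]
        exact hxU
      exact this
    obtain ⟨I, u, hu, hIu⟩ := isOpen_pi_iff.1 hV _ hx₀V
    -- the box: indices `T ∪ I`, windows `u i` on `I` and `C i` off `T`
    let W : ∀ i, Set (G i) := fun i => {g | (i ∈ I → g ∈ u i) ∧ (i ∉ T → g ∈ C i)}
    have hWo : ∀ i ∈ T ∪ I, IsOpen (W i) := by
      intro i _
      refine IsOpen.and ?_ ?_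
      · by_cases hi : i ∈ I
        · simpa [hi] using (hu i hi).1
        · simp [hi]
      · by_cases hi : i ∈ T
        · simp [hi]
        · simpa [hi] using hC i
    refine ⟨{y | (∀ i ∈ T ∪ I, y i ∈ W i) ∧ ∀ i ∉ T ∪ I, y i ∈ C i}, ⟨T ∪ I, W, hWo, rfl⟩, ?_, ?_⟩
    · -- `x` lies in the box
      refine ⟨fun i _ => ⟨fun hi => ?_, fun hi => hxT i hi⟩, fun i hi => hxT i ?_⟩
      · rw [hxi i]
        exact (hu i hi).2
      · exact fun h => hi (Finset.mem_union_left I h)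
    · -- the box lies in `U`
      intro y hy
      have hyC : ∀ i, i ∉ T → y i ∈ C i := by
        intro i hi
        by_cases hiI : i ∈ I
        · exact ((hy.1 i (Finset.mem_union_right T hiI)).2 hi)
        · exact hy.2 i (by rw [Finset.mem_union, not_or]; exact ⟨hi, hiI⟩)
      obtain ⟨y₀, rfl⟩ : y ∈ range (RestrictedProduct.inclusion G C hS) := by
        rw [RestrictedProduct.range_inclusion]
        exact eventually_principal.2 fun i hi => hyC i hi
      have hy₀V : (y₀ : Π i, G i) ∈ V := by
        refine hIu fun i hi => ?_
        exact (hy.1 i (Finset.mem_union_right T (Finset.mem_coe.1 hi))).1 (Finset.mem_coe.1 hi)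
      have : y₀ ∈ RestrictedProduct.inclusion G C hS ⁻¹' U := by
        rw [← hVU]
        exact hy₀V
      exact this

variable {H : ι → Type w} [∀ i, TopologicalSpace (H i)] {D : ∀ i, Set (H i)}

omit [∀ i, TopologicalSpace (G i)] [∀ i, TopologicalSpace (H i)] in
/-- **Images of boxes under a product map are boxes**: if `φ_i(C_i) = D_i` for all `i`, then
`(∏' φ_i) {x | x_i ∈ W_i (i ∈ T), x_i ∈ C_i (i ∉ T)} = {z | z_i ∈ φ_i(W_i) (i ∈ T), z_i ∈ D_i (i ∉ T)}`.
[cite: BorelJacquet1979, §4.1] -/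
theorem image_map_box (φ : ∀ i, G i → H i) (hφ : ∀ᶠ i in cofinite, MapsTo (φ i) (C i) (D i))
    (hCD : ∀ i, φ i '' C i = D i) (T : Finset ι) (W : ∀ i, Set (G i)) :
    RestrictedProduct.map φ hφ '' {x : Πʳ i, [G i, C i] | (∀ i ∈ T, x i ∈ W i) ∧ ∀ i ∉ T, x i ∈ C i} =
      {z : Πʳ i, [H i, D i] | (∀ i ∈ T, z i ∈ φ i '' W i) ∧ ∀ i ∉ T, z i ∈ D i} := by
  classical
  ext z
  constructor
  · rintro ⟨x, ⟨hxT, hxC⟩, rfl⟩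
    refine ⟨fun i hi => ⟨x i, hxT i hi, (RestrictedProduct.map_apply φ hφ x i).symm⟩, fun i hi => ?_⟩
    rw [RestrictedProduct.map_apply, ← hCD i]
    exact mem_image_of_mem _ (hxC i hi)
  · rintro ⟨hzT, hzD⟩
    -- choose preimages: in `W i` on `T`, in `C i` off `T`
    have hzD' : ∀ i, i ∉ T → z i ∈ φ i '' C i := fun i hi => (hCD i).symm ▸ hzD i hi
    let x : Π i, G i := fun i =>
      if hi : i ∈ T then (hzT i hi).choose else (hzD' i hi).choose
    have hxT : ∀ i (hi : i ∈ T), x i ∈ W i ∧ φ i (x i) = z i := fun i hi => by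
      simp only [x, dif_pos hi]
      exact (hzT i hi).choose_spec
    have hxC : ∀ i (hi : i ∉ T), x i ∈ C i ∧ φ i (x i) = z i := fun i hi => by
      simp only [x, dif_neg hi]
      exact (hzD' i hi).choose_spec
    have hx : ∀ᶠ i in cofinite, x i ∈ C i := by
      refine eventually_cofinite.2 (T.finite_toSet.subset fun i hi => ?_)
      by_contra hiT
      exact hi (hxC i (fun h => hiT (Finset.mem_coe.2 h))).1
    refine ⟨⟨x, hx⟩, ⟨fun i hi => (hxT i hi).1, fun i hi => (hxC i hi).1⟩, ?_⟩
    ext i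
    rw [RestrictedProduct.map_apply]
    by_cases hi : i ∈ T
    · exact (hxT i hi).2
    · exact (hxC i hi).2

/-- **Product maps of open maps are open**: if every `φ_i : G_i → H_i` is an open map, the `C_i` and `D_i` are
open and `φ_i(C_i) = D_i`, then `∏' φ_i : Πʳ [G_i, C_i] → Πʳ [H_i, D_i]` is an open map (box by box, via the box
basis). [cite: BorelJacquet1979, §4.1] -/
theorem isOpenMap_map (hC : ∀ i, IsOpen (C i)) (hD : ∀ i, IsOpen (D i)) (φ : ∀ i, G i → H i)
    (hφ : ∀ᶠ i in cofinite, MapsTo (φ i) (C i) (D i)) (hφo : ∀ i, IsOpenMap (φ i))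
    (hCD : ∀ i, φ i '' C i = D i) : IsOpenMap (RestrictedProduct.map φ hφ) := by
  rw [(isTopologicalBasis_boxes hC).isOpenMap_iff]
  rintro U ⟨T, W, hW, rfl⟩
  rw [image_map_box φ hφ hCD T W]
  exact isOpen_box hD T (fun i => φ i '' W i) fun i hi => hφo i _ (hW i hi)

/-- **Product maps are continuous** (Mathlib's `RestrictedProduct.mapAlong_continuous` for a fixed index type).
[cite: BorelJacquet1979, §4.1] -/
theorem continuous_map (φ : ∀ i, G i → H i) (hφ : ∀ᶠ i in cofinite, MapsTo (φ i) (C i) (D i))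
    (hφc : ∀ i, Continuous (φ i)) : Continuous (RestrictedProduct.map φ hφ) :=
  RestrictedProduct.mapAlong_continuous G H id tendsto_id φ hφ hφc

omit [∀ i, TopologicalSpace (G i)] [∀ i, TopologicalSpace (H i)] in
/-- **Product maps of surjections are surjective** when `φ_i(C_i) ⊇ D_i`: every `z` lifts, inside `C_i` off the
finite exceptional set of `z`. [cite: BorelJacquet1979, §4.1] -/
theorem map_surjective (φ : ∀ i, G i → H i) (hφ : ∀ᶠ i in cofinite, MapsTo (φ i) (C i) (D i))
    (hφs : ∀ i, Surjective (φ i)) (hCD : ∀ i, D i ⊆ φ i '' C i) :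
    Surjective (RestrictedProduct.map φ hφ) := by
  classical
  intro z
  have hfin : Set.Finite {i | ¬ z i ∈ D i} := by
    have hz : ∀ᶠ i in cofinite, z i ∈ D i := z.2
    rwa [eventually_cofinite] at hz
  let x : Π i, G i := fun i =>
    if hi : z i ∈ D i then (hCD i hi).choose else (hφs i (z i)).choose
  have hxD : ∀ i (hi : z i ∈ D i), x i ∈ C i ∧ φ i (x i) = z i := fun i hi => by
    simp only [x, dif_pos hi]
    exact (hCD i hi).choose_spec
  have hxD' : ∀ i (hi : ¬ z i ∈ D i), φ i (x i) = z i := fun i hi => by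
    simp only [x, dif_neg hi]
    exact (hφs i (z i)).choose_spec
  have hx : ∀ᶠ i in cofinite, x i ∈ C i := by
    have hz : ∀ᶠ i in cofinite, z i ∈ D i := z.2
    exact hz.mono fun i hi => (hxD i hi).1
  refine ⟨⟨x, hx⟩, ?_⟩
  ext i
  rw [RestrictedProduct.map_apply]
  by_cases hi : z i ∈ D i
  · exact (hxD i hi).2
  · exact hxD' i hi

/-- **`∏' φ_i` is an open quotient map** for open continuous surjections `φ_i` with `φ_i(C_i) = D_i` (`C_i`, `D_i`
open) — the situation of the quotient maps `G_i → G_i ⧸ H_i` along `D_i = φ_i(K_i)`. [cite: BorelJacquet1979, §4.1] -/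
theorem isOpenQuotientMap_map (hC : ∀ i, IsOpen (C i)) (hD : ∀ i, IsOpen (D i)) (φ : ∀ i, G i → H i)
    (hφ : ∀ᶠ i in cofinite, MapsTo (φ i) (C i) (D i)) (hφo : ∀ i, IsOpenMap (φ i))
    (hφc : ∀ i, Continuous (φ i)) (hφs : ∀ i, Surjective (φ i)) (hCD : ∀ i, φ i '' C i = D i) :
    IsOpenQuotientMap (RestrictedProduct.map φ hφ) :=
  IsOpenQuotientMap.of_isOpenMap_isQuotientMap (isOpenMap_map hC hD φ hφ hφo hCD)
    ((isOpenMap_map hC hD φ hφ hφo hCD).isQuotientMap (continuous_map φ hφ hφc)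
      (map_surjective φ hφ hφs fun i => (hCD i).ge))

end Literature.Topology.RestrictedProduct
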